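import Summits.SmoothPoincare4.SmoothPoincare4.Theses.EinsteinBulk

/-!
# Piece X₁ `EinsteinBulk.PEFillStandardSphere` (item stmt-SmoothPoincare4-18033) — birth skeleton `valley-continuity`
# (crux-strategist r1 of PEFillNearRound, 2026-08-17; plan adapted from crux idea `valley-continuity`, Cruxes/PEFillNearRound/Ideas)

PE-FILL(δ) on closed smooth 4-manifolds diffeomorphic to `S⁴` by the CONTINUITY METHOD along smooth one-parameter families of
Yamabe-near-round conformal classes starting at a round class:

* `stub_openAlongFamilies`  — OPENNESS of fillability along such families (Lee 2006 Thm A: a `K ≤ 0` conformally compact Einstein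
  metric has unobstructed deformation theory; `K ≤ 0` on every filling in the cone is Li–Qing–Shi pinching, item 7996; boundary
  regularity Chruściel–Delay–Lee–Skinner 2005) — a theorem to formalise, for `δ'` below the LQS threshold;
* `stub_closedAlongFamilies` — CLOSEDNESS (compactness of Poincaré–Einstein fillings whose conformal infinities run through a
  compact smooth family inside the near-round cone: Chang–Ge–Jin–Qing, arXiv:2107.03075 Thm 1.2 with hypothesis (1″), bulk
  dimension 5 included; the UNIFORMITY of their threshold in the family is the open upgrade) — open;
* `stub_roundFilled` — the round class (sectional curvature ≡ 1) on any `M ≅ S⁴` is PE-filled (hyperbolic 5-space; route item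
  `RoundSphereBoundsHyperbolicSpace` 8003 transported along an isometry with the model sphere) — true, L-sized;
* `stub_valley` — VALLEY: for every `δ' > 0` there is `δ > 0` such that every `δ`-near-round metric on `M ≅ S⁴` is the endpoint of a
  smooth family of `δ'`-near-round metrics starting at a round one (near-maximal superlevel sets of `Y` on `Conf(S⁴)` have no
  islands) — open, S⁴-internal, numerically falsifiable.

Composition `PEFillStandardSphere_of` (REAL proof): `δ' := min δₒ δ_c`; VALLEY at `δ'` gives `δ`; along the family the set of
fillable parameters is clopen in the connected space `[0,1]` and contains `0`, hence contains `1`.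
-/

noncomputable section

set_option linter.dupNamespace false

open scoped Manifold ContDiff Topology ContinuousMap ENNReal
open Set Bundle
open Literature.Geometry.Lorentzian
open Summit.SmoothPoincare4.SmoothPoincare4.Theses

namespace Summit.SmoothPoincare4.SmoothPoincare4.Cruxes.PEFillStandardSphere.ValleyContinuity

/-! ## Vocabulary (all inlined exactly as in the route items) -/

section Defs

variable (M : Type) [TopologicalSpace M] [ChartedSpace (EuclideanSpace ℝ (Fin 4)) M] [IsManifold (𝓡 4) ∞ M]

/-- A `C^∞` Riemannian metric on the 4-manifold `M` (the items' metric type). -/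
abbrev Metric4 : Type :=
  Bundle.ContMDiffRiemannianMetric (𝓡 4) ∞ (EuclideanSpace ℝ (Fin 4)) (TangentSpace (𝓡 4) : M → Type _)

variable [T2Space M] [SecondCountableTopology M] [CompactSpace M] [MeasurableSpace M] [BorelSpace M]

/-- The items' inlined Yamabe clause `Y(M,[g₀]) ≥ (1−δ)·8√6π` (metric form over the conformal class of `g₀`). -/
def YamabeAtLeast (δ : ℝ) (g₀ : Metric4 M) : Prop :=
  ∀ (h' : Metric4 M) [(PseudoRiemannianMetric.ofRiemannian h').HasLeviCivita],
    (∃ φ : M → ℝ, ∀ x : M, 0 < φ x ∧ ∀ v w : TangentSpace (𝓡 4) x, h'.inner x v w = φ x * g₀.inner x v w) →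
      (1 - δ) * (8 * Real.sqrt 6 * Real.pi) * Real.sqrt ((riemannianMeasure h' Set.univ).toReal) ≤
        ∫ x, (PseudoRiemannianMetric.ofRiemannian h').scalarCurvature x ∂(riemannianMeasure h')

/-- The items' inlined conclusion: `(M,[g₀])` is the conformal infinity of a `C²`-conformally compact Einstein 5-manifold. -/
def HasPEFilling (g₀ : Metric4 M) : Prop :=
  ∃ (N : Type) (_ : TopologicalSpace N) (_ : T2Space N) (_ : SecondCountableTopology N)
    (_ : ChartedSpace (EuclideanSpace ℝ (Fin 5)) N) (_ : IsManifold (𝓡 5) ∞ N)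
    (g : Bundle.ContMDiffRiemannianMetric (𝓡 5) ∞ (EuclideanSpace ℝ (Fin 5)) (TangentSpace (𝓡 5) : N → Type _))
    (_ : (PseudoRiemannianMetric.ofRiemannian g).HasLeviCivita),
    (∀ x, (PseudoRiemannianMetric.ofRiemannian g).ricci x =
        (-4 : ℝ) • (PseudoRiemannianMetric.ofRiemannian g).toBilinForm x) ∧
    (∃ (X : Type) (_ : TopologicalSpace X) (_ : T2Space X) (_ : SecondCountableTopology X)
      (_ : ChartedSpace (EuclideanHalfSpace 5) X) (_ : IsManifold (𝓡∂ 5) ∞ X) (_ : CompactSpace X)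
      (_ : ConnectedSpace X) (j : N → X) (ι : M → X) (ρ : X → ℝ)
      (gb : Bundle.ContMDiffRiemannianMetric (𝓡∂ 5) 2 (EuclideanSpace ℝ (Fin 5)) (TangentSpace (𝓡∂ 5) : X → Type _)),
      Manifold.IsSmoothEmbedding (𝓡 5) (𝓡∂ 5) ∞ j ∧ Set.range j = (𝓡∂ 5).interior X ∧
      Manifold.IsSmoothEmbedding (𝓡 4) (𝓡∂ 5) ∞ ι ∧ Set.range ι = (𝓡∂ 5).boundary X ∧
      ContMDiff (𝓡∂ 5) 𝓘(ℝ, ℝ) ∞ ρ ∧ (∀ x : X, 0 ≤ ρ x) ∧ (∀ x : X, ρ x = 0 ↔ x ∈ (𝓡∂ 5).boundary X) ∧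
      (∀ y : M, ∃ ν : TangentSpace (𝓡∂ 5) (ι y), gb.inner (ι y) ν ν = 1 ∧
        ∀ v : TangentSpace (𝓡∂ 5) (ι y), gb.inner (ι y) ν v = mfderiv (𝓡∂ 5) 𝓘(ℝ, ℝ) ρ (ι y) v) ∧
      (∀ (x : N) (v w : TangentSpace (𝓡 5) x),
        gb.inner (j x) (mfderiv (𝓡 5) (𝓡∂ 5) j x v) (mfderiv (𝓡 5) (𝓡∂ 5) j x w) = ρ (j x) ^ 2 * g.inner x v w) ∧
      (∃ φ : M → ℝ, ∀ y : M, 0 < φ y ∧ ∀ v w : TangentSpace (𝓡 4) y,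
        gb.inner (ι y) (mfderiv (𝓡 4) (𝓡∂ 5) ι y v) (mfderiv (𝓡 4) (𝓡∂ 5) ι y w) = φ y * g₀.inner y v w))

/-- A one-parameter family of metrics is SMOOTH: jointly `C^∞` in `(t, x)` when tested on smooth vector fields. -/
def IsSmoothFamily (H : ℝ → Metric4 M) : Prop :=
  ∀ V W : (x : M) → TangentSpace (𝓡 4) x,
    ContMDiff (𝓡 4) (𝓡 4).tangent ∞ (fun x => (TotalSpace.mk' (EuclideanSpace ℝ (Fin 4)) x (V x) : TangentBundle (𝓡 4) M)) →
    ContMDiff (𝓡 4) (𝓡 4).tangent ∞ (fun x => (TotalSpace.mk' (EuclideanSpace ℝ (Fin 4)) x (W x) : TangentBundle (𝓡 4) M)) →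
      ContMDiff (𝓘(ℝ, ℝ).prod (𝓡 4)) 𝓘(ℝ, ℝ) ∞ (fun p : ℝ × M => (H p.1).inner p.2 (V p.2) (W p.2))

/-- A metric is ROUND: sectional curvature `≡ 1` on orthonormal pairs (so, on a closed simply connected 4-manifold, isometric to
the unit sphere). -/
def IsRound (g : Metric4 M) [(PseudoRiemannianMetric.ofRiemannian g).HasLeviCivita] : Prop :=
  ∀ (x : M) (X Y : TangentSpace (𝓡 4) x), g.inner x X X = 1 → g.inner x Y Y = 1 → g.inner x X Y = 0 →
    (PseudoRiemannianMetric.ofRiemannian g).curvatureForm (PseudoRiemannianMetric.ofRiemannian g).leviCivita x X Y Y X = 1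

end Defs

/-- Local notation for the model 4-sphere. -/
local notation "𝕊⁴" => (Metric.sphere (0 : EuclideanSpace ℝ (Fin 5)) 1)

/-! ## The four statements of the continuity method -/

/-- ROUND CLASSES ARE FILLED on manifolds diffeomorphic to `S⁴` (ℍ⁵ in the ball model, transported). -/
def RoundFilled : Prop :=
  ∀ (M : Type) [TopologicalSpace M] [T2Space M] [SecondCountableTopology M] [ChartedSpace (EuclideanSpace ℝ (Fin 4)) M]
    [IsManifold (𝓡 4) ∞ M] [CompactSpace M] [ConnectedSpace M] [MeasurableSpace M] [BorelSpace M],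
    Nonempty (M ≃ₘ⟮𝓡 4, 𝓡 4⟯ 𝕊⁴) → ∀ (g : Metric4 M) [(PseudoRiemannianMetric.ofRiemannian g).HasLeviCivita],
      IsRound M g → HasPEFilling M g

/-- OPENNESS of PE-fillability along smooth `δ'`-near-round families on `M ≅ S⁴`. -/
def OpenAlongFamilies (δ' : ℝ) : Prop :=
  ∀ (M : Type) [TopologicalSpace M] [T2Space M] [SecondCountableTopology M] [ChartedSpace (EuclideanSpace ℝ (Fin 4)) M]
    [IsManifold (𝓡 4) ∞ M] [CompactSpace M] [ConnectedSpace M] [MeasurableSpace M] [BorelSpace M],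
    Nonempty (M ≃ₘ⟮𝓡 4, 𝓡 4⟯ 𝕊⁴) → ∀ (H : ℝ → Metric4 M), IsSmoothFamily M H →
      (∀ t ∈ Set.Icc (0 : ℝ) 1, YamabeAtLeast M δ' (H t)) → IsOpen {t : Set.Icc (0 : ℝ) 1 | HasPEFilling M (H t)}

/-- CLOSEDNESS of PE-fillability along smooth `δ'`-near-round families on `M ≅ S⁴` (near-round CCE compactness, uniform). -/
def ClosedAlongFamilies (δ' : ℝ) : Prop :=
  ∀ (M : Type) [TopologicalSpace M] [T2Space M] [SecondCountableTopology M] [ChartedSpace (EuclideanSpace ℝ (Fin 4)) M]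
    [IsManifold (𝓡 4) ∞ M] [CompactSpace M] [ConnectedSpace M] [MeasurableSpace M] [BorelSpace M],
    Nonempty (M ≃ₘ⟮𝓡 4, 𝓡 4⟯ 𝕊⁴) → ∀ (H : ℝ → Metric4 M), IsSmoothFamily M H →
      (∀ t ∈ Set.Icc (0 : ℝ) 1, YamabeAtLeast M δ' (H t)) → IsClosed {t : Set.Icc (0 : ℝ) 1 | HasPEFilling M (H t)}

/-- VALLEY: near-maximal superlevel sets of the Yamabe functional reach a round class by smooth near-maximal paths, uniformly. -/
def Valley : Prop :=
  ∀ δ' : ℝ, 0 < δ' → ∃ δ : ℝ, 0 < δ ∧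
    ∀ (M : Type) [TopologicalSpace M] [T2Space M] [SecondCountableTopology M] [ChartedSpace (EuclideanSpace ℝ (Fin 4)) M]
      [IsManifold (𝓡 4) ∞ M] [CompactSpace M] [ConnectedSpace M] [MeasurableSpace M] [BorelSpace M],
      Nonempty (M ≃ₘ⟮𝓡 4, 𝓡 4⟯ 𝕊⁴) → ∀ (g : Metric4 M), YamabeAtLeast M δ g →
        ∃ (H : ℝ → Metric4 M) (_ : (PseudoRiemannianMetric.ofRiemannian (H 0)).HasLeviCivita),
          IsSmoothFamily M H ∧ IsRound M (H 0) ∧ H 1 = g ∧ ∀ t ∈ Set.Icc (0 : ℝ) 1, YamabeAtLeast M δ' (H t)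

/-! ## Monotonicity in the slack parameter (proved) -/

theorem yamabeBound_mono {δ δ' C V I : ℝ} (hδ : δ' ≤ δ) (hC : 0 ≤ C) (hV : 0 ≤ V)
    (h : (1 - δ') * C * V ≤ I) : (1 - δ) * C * V ≤ I :=
  (mul_le_mul_of_nonneg_right (mul_le_mul_of_nonneg_right (sub_le_sub_left hδ 1) hC) hV).trans h

section Mono

variable {M : Type} [TopologicalSpace M] [ChartedSpace (EuclideanSpace ℝ (Fin 4)) M] [IsManifold (𝓡 4) ∞ M] [CompactSpace M]
  [T2Space M] [MeasurableSpace M] [BorelSpace M]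

theorem YamabeAtLeast.mono {δ δ' : ℝ} (hδ : δ' ≤ δ) {g : Metric4 M} (h : YamabeAtLeast M δ' g) : YamabeAtLeast M δ g :=
  fun h' _ hconf => yamabeBound_mono hδ (by positivity) (Real.sqrt_nonneg _) (h h' hconf)

end Mono

theorem OpenAlongFamilies.mono {δ δ' : ℝ} (hδ : δ' ≤ δ) (h : OpenAlongFamilies δ) : OpenAlongFamilies δ' :=
  fun M _ _ _ _ _ _ _ _ _ hstd H hH hY => h M hstd H hH (fun t ht => (hY t ht).mono hδ)

theorem ClosedAlongFamilies.mono {δ δ' : ℝ} (hδ : δ' ≤ δ) (h : ClosedAlongFamilies δ) : ClosedAlongFamilies δ' :=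
  fun M _ _ _ _ _ _ _ _ _ hstd H hH hY => h M hstd H hH (fun t ht => (hY t ht).mono hδ)

/-! ## The registered stubs -/

/-- **Stub 1 — OPENNESS** at some positive slack `δₒ` (Lee 2006 Thm A + Li–Qing–Shi pinching + CDLS boundary regularity).
[cite: Lee2006, Thm A] [cite: LiQingShi2017, Thm 1.8] [cite: ChruscielEtAl2005, Thm A] -/
theorem stub_openAlongFamilies : ∃ δₒ : ℝ, 0 < δₒ ∧ OpenAlongFamilies δₒ := by
  sorry

/-- **Stub 2 — CLOSEDNESS** at some positive slack `δ_c` (near-round CCE compactness in bulk dimension 5 with a family-uniform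
threshold: Chang–Ge–Jin–Qing III Thm 1.2 (1″) + one more compactness loop). [cite: arXiv:2107.03075, Thm 1.2] [cite: LiQingShi2017] -/
theorem stub_closedAlongFamilies : ∃ δc : ℝ, 0 < δc ∧ ClosedAlongFamilies δc := by
  sorry

/-- **Stub 3 — ROUND CLASSES ARE FILLED** (hyperbolic 5-space; item 8003 transported along the isometry `M ≅ S⁴_round`).
[cite: GrahamLee1991] -/
theorem stub_roundFilled : RoundFilled := by
  sorry

/-- **Stub 4 — VALLEY** (no islands in the near-maximal Yamabe landscape of `S⁴`). [cite: Kobayashi1987] [cite: Schoen1989]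
[cite: arXiv:math/0603486] -/
theorem stub_valley : Valley := by
  sorry

/-! ## The composition: the piece BY NAME (real proof; sorries only inside `stub_*`) -/

/-- **THE SKELETON THEOREM: `EinsteinBulk.PEFillStandardSphere` BY NAME from the four registered stubs.** Continuity argument:
`δ' := min δₒ δc`; VALLEY at `δ'` gives `δ`; along the family the set of fillable parameters is clopen in the connected `[0,1]` and
contains `0`, hence `1`. -/
theorem PEFillStandardSphere_of : EinsteinBulk.PEFillStandardSphere := by
  obtain ⟨δₒ, hδₒ, HO⟩ := stub_openAlongFamilies
  obtain ⟨δc, hδc, HC⟩ := stub_closedAlongFamilies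
  obtain ⟨δ, hδ, HV⟩ := stub_valley (min δₒ δc) (lt_min hδₒ hδc)
  refine ⟨δ, hδ, ?_⟩
  intro M _ _ _ _ _ _ _ _ _ hstd g₀ hY
  obtain ⟨H, hLC0, hsm, hround, h1, hYfam⟩ := HV M hstd g₀ hY
  have hOδ : OpenAlongFamilies (min δₒ δc) := HO.mono (min_le_left _ _)
  have hCδ : ClosedAlongFamilies (min δₒ δc) := HC.mono (min_le_right _ _)
  set S : Set (Set.Icc (0 : ℝ) 1) := {t | HasPEFilling M (H t)} with hSdef
  have hSo : IsOpen S := hOδ M hstd H hsm hYfam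
  have hSc : IsClosed S := hCδ M hstd H hsm hYfam
  have h0 : (⟨0, Set.left_mem_Icc.mpr zero_le_one⟩ : Set.Icc (0 : ℝ) 1) ∈ S :=
    stub_roundFilled M hstd (H 0) hround
  haveI : PreconnectedSpace (Set.Icc (0 : ℝ) 1) := Subtype.preconnectedSpace isPreconnected_Icc
  have hS : S = Set.univ := IsClopen.eq_univ ⟨hSc, hSo⟩ ⟨_, h0⟩
  have h1mem : (⟨1, Set.right_mem_Icc.mpr zero_le_one⟩ : Set.Icc (0 : ℝ) 1) ∈ S := by
    rw [hS]; trivial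
  have hfill : HasPEFilling M (H 1) := h1mem
  rw [h1] at hfill
  exact hfill

end Summit.SmoothPoincare4.SmoothPoincare4.Cruxes.PEFillStandardSphere.ValleyContinuity

end
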